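/-
Copyright: the b2b-balaban T⁴-continuum CRUX team, row NE7b OWNER lineage `t4-ne7b-p1` (gen 130). Project licence.
-/
import Summits.QuantumFields.BalabanUV.T4Continuum.Spine.NE7b.SupEffectiveActionLocalExpansion
import Summits.QuantumFields.BalabanUV.T4Continuum.Spine.NE7b.SupEffectiveActionLocality

/-!
# THE MIXED SECOND DIFFERENCE OF THE EFFECTIVE ACTION UNDER TWO LOCAL CHANGES IS CARRIED BY THE CLUSTERS TOUCHING BOTH LOCI, HENCE IS
# EXPONENTIALLY SMALL IN THEIR SEPARATION: for four factor families `g_{st}`, `s, t ∈ {0,1}`, whose activities differ in `s` only on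
# polymers meeting `D_a` and in `t` only on polymers meeting `D_b`,
#   `log Z₁₁(C) − log Z₁₀(C) − log Z₀₁(C) + log Z₀₀(C) = Σ_{𝒞 touching D_a AND D_b} (Φ₁₁ − Φ₁₀ − Φ₀₁ + Φ₀₀)^T(𝒞)`,
# and if every CLUSTER touching both loci has total size `≥ m` (the loci are far apart), the Kotecký–Preiss decay weight gives
#   `‖log Z₁₁ − log Z₁₀ − log Z₀₁ + log Z₀₀‖ ≤ 4·e^{−τm}·#D_a·(Δ+1)·2e^{1+τ}ε`
# uniformly in the volume — the two-locus refinement of (311)'s locality, the combinatorial half of the decay of the tilted law's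
# correlations (row NE7b, node U5c; (311)∕(312) + the tree's `truncatedWeight_eq_zero_of_kp` BY NAME; [folklore])

Cell `pub-balaban`, sub-cell `t4`, spine estimate NE7b (`T4WeightBudget.RelWeightBound`; the cell's OWN estimate — NOT PRINTED in
[Bałaban 1983–89], NOT PROVED).  Crux-route work under `Spine/NE7b/` by the row OWNER (`t4-ne7b-p1` gen 130, file (324)) under FREEZE
(0)'s crux-prover clause, on § [NE7bP1-G129-HANDOFF] NEXT (i)∕(ii) («the `O(ε)` covariance bound from (312)'s cluster expansion»: the
covariance `Cov_ν(F_a, G_b)` of two one-site observables is the mixed derivative of `log Z` in two one-site perturbations, whose mixed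
DIFFERENCES this file bounds); NOTHING of Bałaban's is named as a Lean object, valued or asserted; no `T4Continuum/Support` leaf typed; no
`def`, no notation; zero `sorry`.  Imports (BY NAME): the OWNER's (312) `…SupEffectiveActionLocalExpansion`
(`act_sum_norm_truncatedWeight_large_pinned_le`, `smallness_of_decay`), (311) `…SupEffectiveActionLocality` (`sum_norm_le_sum_pinned`),
(287) (`act_isKPVolume_connActivity`); the tree's `LocalPerturbationClusterExpansion` (`pertLogZ_eq_sum_truncatedWeight`), `ClusterExpansion`
(`truncatedWeight_congr`, `truncatedWeight_eq_zero_of_kp`, `IsPolymerCluster`, `KPTouches`), `LocalPerturbationPolymerGas` (`mem_rconnSubsets`,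
`connActivity`), `PolymerGasGeometric` (`GeomInc`).

WHY (located).  The Hessian of the next potential is `⟨D₂⟩_ν − Cov_ν(D, D)` ((320)); its LOCALITY — decay of `Cov_ν(w'_x, w'_z)` in the
separation of the cells of `x` and `z` — is what lets the next Gaussian step see a local quadratic form, and what a volume-uniform
third-order bound needs ((323) supplies the single-site moments).  `Cov_ν(F_a, G_b) = ∂_s∂_t log Z(w − s1_aF, w − t1_bG)|₀`; the present
file controls the finite mixed differences of `log Z` under such two-locus changes by the clusters that touch BOTH loci: all other
clusters cancel in the alternating sum (their truncated functionals do not see one of the two changes), the survivors are clusters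
(off clusters `Φ^T = 0` in a KP volume), and clusters through two far-apart loci are large, so (312)'s decay weight makes them
exponentially small.  The passage from differences to the derivative (Cauchy estimates in complex `s, t`, or second activity-derivatives
of `log Z`) is the successor's.

WHAT IS PROVED ([folklore]; activity level as in (287)∕(311)∕(312): `R` symmetric with `≤ Δ` neighbours; four families `g₀₀, g₁₀, g₀₁, g₁₁`
with `‖M_{st}(K)‖ ≤ ε^{#K}` on `R`-connected `K`, `0 ≤ ε`; loci `D_a, D_b ⊆ V`; AGREEMENT: on polymers `K ⊆ C` disjoint from `D_a`,
`M₁₀(K) = M₀₀(K)` and `M₁₁(K) = M₀₁(K)`; on polymers disjoint from `D_b`, `M₀₁(K) = M₀₀(K)` and `M₁₁(K) = M₁₀(K)`):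
* §1 `mixed_bracket_eq_zero_of_not_touches` (a family of polymers touching no cell of `D_a`, or none of `D_b`, has
  `Φ₁₁ − Φ₁₀ − Φ₀₁ + Φ₀₀ = 0`), `mixed_bracket_support` (`eε(Δ+1)² ≤ 1∕2`: a non-zero bracket forces a CLUSTER touching both loci),
  **`act_norm_pertLogZ_mixed_le_sum`** (`‖log Z₁₁ − log Z₁₀ − log Z₀₁ + log Z₀₀‖ ≤ Σ_{𝒞 touching D_a and D_b}(‖Φ₁₁‖+‖Φ₁₀‖+‖Φ₀₁‖+‖Φ₀₀‖)(𝒞)`);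
* §2 `sum_norm_le_sum_pinned_large` (pinning with a size constraint), THE END **`act_norm_pertLogZ_mixed_le`** (`0 ≤ τ`,
  `e^{1+τ}ε(Δ+1)² ≤ 1∕2`, and SEPARATION: every cluster `𝒞 ⊆ 𝒫(C)` touching both `D_a` and `D_b` has `m ≤ ‖𝒞‖ = Σ_{Y∈𝒞}#Y` ⟹
  `‖log Z₁₁ − log Z₁₀ − log Z₀₁ + log Z₀₀‖ ≤ 4·e^{−τm}·(#D_a·(Δ+1)·2e^{1+τ}ε)`); §3 toy.

HONEST (what this is NOT).  Finite DIFFERENCES of `log Z`, not the mixed derivative (the covariance itself): the bound is `O(ε·e^{−τm})`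
uniformly in the size of the two changes, not bilinear in them — converting it into `|Cov_ν(F_a,G_b)| ≤ C·e^{−τm}` needs analyticity in the
perturbation parameters (Cauchy) or activity-derivative bounds, NOT here; the separation hypothesis is stated at the cluster level (its
discharge from a distance on cells — a cluster through two loci at distance `d` has `‖𝒞‖ ≥ d+1` — is not typed); abstract activity level
(the road's regulated∕shifted dictionaries (289)∕(296)∕(306) instantiate it as for (311)); scalar skeleton ((A3), NC-NE7b-α UNRULED); nothing
of Bałaban's asserted.  BY-NAME EFFECT ON THE WALL: NONE.  NE7b NOT PRINTED ∕ NOT PROVED; spine PROVED 0∕9; rung (B)+1 — the programme's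
measures remain FINITE-torus statements; NOT the mass gap, NOT Clay.  HONEST DEPENDENCY: continuum YM on T⁴ ⇐ BetaPertH ∧ nine spine estimates
(0∕9 proved); BetaPertH ⇐ (D1) ∧ (D4) ∧ CAP+tail; G-an2-4 gates asym, D1 and NE2∕3∕4.
-/

set_option autoImplicit false

noncomputable section

namespace Summit.QuantumFields.BalabanUV.T4Continuum.NE7b.SupEffectiveActionMixedLocality

open MeasureTheory ProbabilityTheory Finset Real
open scoped BigOperators
open Literature.Probability.LatticeModels
open SupEffectiveActionLocalExpansion (act_sum_norm_truncatedWeight_large_pinned_le smallness_of_decay)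
open SupActivityPolymerGas (act_isKPVolume_connActivity)

variable {V : Type*} [DecidableEq V] {Ω : Type*} {mΩ : MeasurableSpace Ω} {μ : Measure Ω} {R : V → V → Prop} [DecidableRel R]
  {g₀₀ g₁₀ g₀₁ g₁₁ : V → Ω → ℂ} {ε τ : ℝ} {nbr : V → Finset V} {Δ : ℕ}

/-! ## §1. Clusters not touching both loci cancel in the alternating sum -/

/-- **THE MIXED BRACKET OF A FAMILY OF POLYMERS NOT TOUCHING BOTH LOCI VANISHES**: if the activities change in `s` only on polymers
meeting `D_a` and in `t` only on polymers meeting `D_b`, then for every family `𝒞` of `R`-connected subsets of `C` touching no cell of `D_a`,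
or no cell of `D_b`, `Φ₁₁^T(𝒞) − Φ₁₀^T(𝒞) − Φ₀₁^T(𝒞) + Φ₀₀^T(𝒞) = 0`. [folklore] -/
theorem mixed_bracket_eq_zero_of_not_touches (C Da Db : Finset V)
    (ha : ∀ K : Finset V, K ⊆ C → Disjoint K Da →
      cellActivity μ g₁₀ K = cellActivity μ g₀₀ K ∧ cellActivity μ g₁₁ K = cellActivity μ g₀₁ K)
    (hb : ∀ K : Finset V, K ⊆ C → Disjoint K Db →
      cellActivity μ g₀₁ K = cellActivity μ g₀₀ K ∧ cellActivity μ g₁₁ K = cellActivity μ g₁₀ K)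
    {𝒞 : Finset (Finset V)} (h𝒞 : 𝒞 ∈ (rconnSubsets R C).powerset)
    (hnot : ¬ ((∃ q ∈ Da, KPTouches (GeomInc R) 𝒞 {q}) ∧ (∃ q ∈ Db, KPTouches (GeomInc R) 𝒞 {q}))) :
    truncatedWeight (GeomInc R) (connActivity R μ g₁₁) 𝒞 - truncatedWeight (GeomInc R) (connActivity R μ g₁₀) 𝒞 -
      truncatedWeight (GeomInc R) (connActivity R μ g₀₁) 𝒞 + truncatedWeight (GeomInc R) (connActivity R μ g₀₀) 𝒞 = 0 := by
  -- a polymer of `𝒞` meeting a locus makes `𝒞` touch a singleton of that locus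
  have hdisj : ∀ D : Finset V, (¬ ∃ q ∈ D, KPTouches (GeomInc R) 𝒞 {q}) → ∀ Y ∈ 𝒞, Disjoint Y D := fun D hD Y hY =>
    Finset.disjoint_left.2 fun q hqY hqD => hD ⟨q, hqD, Y, hY, Or.inr ⟨q, hqY, q, mem_singleton_self q, Or.inl rfl⟩⟩
  have hcongr : ∀ {g g' : V → Ω → ℂ} (D : Finset V), (¬ ∃ q ∈ D, KPTouches (GeomInc R) 𝒞 {q}) →
      (∀ K : Finset V, K ⊆ C → Disjoint K D → cellActivity μ g K = cellActivity μ g' K) →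
      truncatedWeight (GeomInc R) (connActivity R μ g) 𝒞 = truncatedWeight (GeomInc R) (connActivity R μ g') 𝒞 := by
    intro g g' D hD hag
    refine truncatedWeight_congr fun Y hY => ?_
    obtain ⟨hYC, hYconn⟩ := mem_rconnSubsets.1 (mem_powerset.1 h𝒞 hY)
    unfold connActivity
    simp only [hYconn, if_true]
    exact hag Y hYC (hdisj D hD Y hY)
  rw [not_and_or] at hnot
  rcases hnot with hA | hB
  · rw [hcongr Da hA (fun K hK hKD => (ha K hK hKD).2), hcongr Da hA (fun K hK hKD => (ha K hK hKD).1)]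
    ring
  · rw [hcongr Db hB (fun K hK hKD => (hb K hK hKD).2), hcongr (g := g₀₁) Db hB (fun K hK hKD => (hb K hK hKD).1)]
    ring

/-- **THE SUPPORT OF THE MIXED BRACKET**: `R` symmetric with `≤ Δ` neighbours; four families with `‖M_{st}(K)‖ ≤ ε^{#K}` on
`R`-connected `K` (`0 ≤ ε`, `eε(Δ+1)² ≤ 1∕2`); the two agreement letters ⟹ a family `𝒞 ⊆ 𝒫(C)` with non-zero bracket
`Φ₁₁^T − Φ₁₀^T − Φ₀₁^T + Φ₀₀^T` is a CLUSTER (off clusters every `Φ^T` vanishes in a KP volume) touching a cell of `D_a` AND a cell of `D_b`.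
[folklore] -/
theorem mixed_bracket_support (hR : ∀ x y, R x y → R y x) (hΔ : ∀ x, (nbr x).card ≤ Δ) (hnbr : ∀ x y, R x y → y ∈ nbr x)
    (h00 : ∀ K : Finset V, IsRConnected R K → ‖cellActivity μ g₀₀ K‖ ≤ ε ^ K.card)
    (h10 : ∀ K : Finset V, IsRConnected R K → ‖cellActivity μ g₁₀ K‖ ≤ ε ^ K.card)
    (h01 : ∀ K : Finset V, IsRConnected R K → ‖cellActivity μ g₀₁ K‖ ≤ ε ^ K.card)
    (h11 : ∀ K : Finset V, IsRConnected R K → ‖cellActivity μ g₁₁ K‖ ≤ ε ^ K.card) (hε : 0 ≤ ε)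
    (hsmall : Real.exp 1 * ε * ((Δ : ℝ) + 1) ^ 2 ≤ 1 / 2) (C Da Db : Finset V)
    (ha : ∀ K : Finset V, K ⊆ C → Disjoint K Da →
      cellActivity μ g₁₀ K = cellActivity μ g₀₀ K ∧ cellActivity μ g₁₁ K = cellActivity μ g₀₁ K)
    (hb : ∀ K : Finset V, K ⊆ C → Disjoint K Db →
      cellActivity μ g₀₁ K = cellActivity μ g₀₀ K ∧ cellActivity μ g₁₁ K = cellActivity μ g₁₀ K)
    {𝒞 : Finset (Finset V)} (h𝒞 : 𝒞 ∈ (rconnSubsets R C).powerset)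
    (hne : truncatedWeight (GeomInc R) (connActivity R μ g₁₁) 𝒞 - truncatedWeight (GeomInc R) (connActivity R μ g₁₀) 𝒞 -
      truncatedWeight (GeomInc R) (connActivity R μ g₀₁) 𝒞 + truncatedWeight (GeomInc R) (connActivity R μ g₀₀) 𝒞 ≠ 0) :
    IsPolymerCluster (GeomInc R) 𝒞 ∧ (∃ q ∈ Da, KPTouches (GeomInc R) 𝒞 {q}) ∧ (∃ q ∈ Db, KPTouches (GeomInc R) 𝒞 {q}) := by
  haveI : Std.Symm R := ⟨hR⟩
  refine ⟨?_, ?_⟩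
  · by_contra hcl
    have h𝒞L : 𝒞 ⊆ rconnSubsets R C := mem_powerset.1 h𝒞
    have z11 := truncatedWeight_eq_zero_of_kp (act_isKPVolume_connActivity hR hΔ hnbr h11 hε hsmall (rconnSubsets R C)) h𝒞L hcl
    have z10 := truncatedWeight_eq_zero_of_kp (act_isKPVolume_connActivity hR hΔ hnbr h10 hε hsmall (rconnSubsets R C)) h𝒞L hcl
    have z01 := truncatedWeight_eq_zero_of_kp (act_isKPVolume_connActivity hR hΔ hnbr h01 hε hsmall (rconnSubsets R C)) h𝒞L hcl
    have z00 := truncatedWeight_eq_zero_of_kp (act_isKPVolume_connActivity hR hΔ hnbr h00 hε hsmall (rconnSubsets R C)) h𝒞L hcl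
    exact hne (by rw [z11, z10, z01, z00]; ring)
  · by_contra hnot
    exact hne (mixed_bracket_eq_zero_of_not_touches (μ := μ) (R := R) C Da Db ha hb h𝒞 hnot)

/-- **THE MIXED SECOND DIFFERENCE IS CARRIED BY THE FAMILIES TOUCHING BOTH LOCI.**  Under the hypotheses of `mixed_bracket_support`,
`‖log Z₁₁(C) − log Z₁₀(C) − log Z₀₁(C) + log Z₀₀(C)‖ ≤ Σ_{𝒞 ⊆ 𝒫(C) touching D_a and D_b}(‖Φ₁₁^T‖+‖Φ₁₀^T‖+‖Φ₀₁^T‖+‖Φ₀₀^T‖)(𝒞)`. [folklore] -/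
theorem act_norm_pertLogZ_mixed_le_sum (hR : ∀ x y, R x y → R y x) (hΔ : ∀ x, (nbr x).card ≤ Δ) (hnbr : ∀ x y, R x y → y ∈ nbr x)
    (h00 : ∀ K : Finset V, IsRConnected R K → ‖cellActivity μ g₀₀ K‖ ≤ ε ^ K.card)
    (h10 : ∀ K : Finset V, IsRConnected R K → ‖cellActivity μ g₁₀ K‖ ≤ ε ^ K.card)
    (h01 : ∀ K : Finset V, IsRConnected R K → ‖cellActivity μ g₀₁ K‖ ≤ ε ^ K.card)
    (h11 : ∀ K : Finset V, IsRConnected R K → ‖cellActivity μ g₁₁ K‖ ≤ ε ^ K.card) (hε : 0 ≤ ε)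
    (hsmall : Real.exp 1 * ε * ((Δ : ℝ) + 1) ^ 2 ≤ 1 / 2) (C Da Db : Finset V)
    (ha : ∀ K : Finset V, K ⊆ C → Disjoint K Da →
      cellActivity μ g₁₀ K = cellActivity μ g₀₀ K ∧ cellActivity μ g₁₁ K = cellActivity μ g₀₁ K)
    (hb : ∀ K : Finset V, K ⊆ C → Disjoint K Db →
      cellActivity μ g₀₁ K = cellActivity μ g₀₀ K ∧ cellActivity μ g₁₁ K = cellActivity μ g₁₀ K) :
    ‖pertLogZ μ g₁₁ R C - pertLogZ μ g₁₀ R C - pertLogZ μ g₀₁ R C + pertLogZ μ g₀₀ R C‖ ≤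
      ∑ 𝒞 ∈ (rconnSubsets R C).powerset with (∃ q ∈ Da, KPTouches (GeomInc R) 𝒞 {q}) ∧ (∃ q ∈ Db, KPTouches (GeomInc R) 𝒞 {q}),
        (‖truncatedWeight (GeomInc R) (connActivity R μ g₁₁) 𝒞‖ + ‖truncatedWeight (GeomInc R) (connActivity R μ g₁₀) 𝒞‖ +
          ‖truncatedWeight (GeomInc R) (connActivity R μ g₀₁) 𝒞‖ + ‖truncatedWeight (GeomInc R) (connActivity R μ g₀₀) 𝒞‖) := by
  classical
  set L := rconnSubsets R C with hL
  set Φ₁₁ : Finset (Finset V) → ℂ := truncatedWeight (GeomInc R) (connActivity R μ g₁₁) with hΦ₁₁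
  set Φ₁₀ : Finset (Finset V) → ℂ := truncatedWeight (GeomInc R) (connActivity R μ g₁₀) with hΦ₁₀
  set Φ₀₁ : Finset (Finset V) → ℂ := truncatedWeight (GeomInc R) (connActivity R μ g₀₁) with hΦ₀₁
  set Φ₀₀ : Finset (Finset V) → ℂ := truncatedWeight (GeomInc R) (connActivity R μ g₀₀) with hΦ₀₀
  have hexp : pertLogZ μ g₁₁ R C - pertLogZ μ g₁₀ R C - pertLogZ μ g₀₁ R C + pertLogZ μ g₀₀ R C =
      ∑ 𝒞 ∈ L.powerset, (Φ₁₁ 𝒞 - Φ₁₀ 𝒞 - Φ₀₁ 𝒞 + Φ₀₀ 𝒞) := by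
    rw [pertLogZ_eq_sum_truncatedWeight, pertLogZ_eq_sum_truncatedWeight, pertLogZ_eq_sum_truncatedWeight,
      pertLogZ_eq_sum_truncatedWeight, sum_add_distrib, sum_sub_distrib, sum_sub_distrib]
  rw [hexp]
  have hvanish : ∀ 𝒞 ∈ L.powerset, Φ₁₁ 𝒞 - Φ₁₀ 𝒞 - Φ₀₁ 𝒞 + Φ₀₀ 𝒞 ≠ 0 →
      (∃ q ∈ Da, KPTouches (GeomInc R) 𝒞 {q}) ∧ (∃ q ∈ Db, KPTouches (GeomInc R) 𝒞 {q}) :=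
    fun 𝒞 h𝒞 hne => (mixed_bracket_support (μ := μ) hR hΔ hnbr h00 h10 h01 h11 hε hsmall C Da Db ha hb h𝒞 hne).2
  rw [← sum_filter_of_ne hvanish]
  refine (norm_sum_le _ _).trans (sum_le_sum fun 𝒞 _ => ?_)
  calc ‖Φ₁₁ 𝒞 - Φ₁₀ 𝒞 - Φ₀₁ 𝒞 + Φ₀₀ 𝒞‖ ≤ ‖Φ₁₁ 𝒞 - Φ₁₀ 𝒞 - Φ₀₁ 𝒞‖ + ‖Φ₀₀ 𝒞‖ := norm_add_le _ _
    _ ≤ ‖Φ₁₁ 𝒞 - Φ₁₀ 𝒞‖ + ‖Φ₀₁ 𝒞‖ + ‖Φ₀₀ 𝒞‖ := by linarith [norm_sub_le (Φ₁₁ 𝒞 - Φ₁₀ 𝒞) (Φ₀₁ 𝒞)]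
    _ ≤ ‖Φ₁₁ 𝒞‖ + ‖Φ₁₀ 𝒞‖ + ‖Φ₀₁ 𝒞‖ + ‖Φ₀₀ 𝒞‖ := by linarith [norm_sub_le (Φ₁₁ 𝒞) (Φ₁₀ 𝒞)]

/-! ## §2. THE END: clusters through two far-apart loci are large, hence exponentially small -/

/-- **Pinning with a size constraint**: a nonnegative cluster functional summed over the clusters touching SOME cell of `D` and of total
size `≥ m` is at most the sum over `q ∈ D` of its pinned-at-`{q}`, size-`≥ m` sums. [folklore] -/
theorem sum_norm_le_sum_pinned_large (𝓛 : Finset (Finset (Finset V))) (D : Finset V) (m : ℝ) (a : Finset (Finset V) → ℝ)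
    (ha : ∀ 𝒞, 0 ≤ a 𝒞) :
    ∑ 𝒞 ∈ 𝓛 with (∃ q ∈ D, KPTouches (GeomInc R) 𝒞 {q}) ∧ m ≤ ∑ Y ∈ 𝒞, (Y.card : ℝ), a 𝒞 ≤
      ∑ q ∈ D, ∑ 𝒞 ∈ 𝓛 with KPTouches (GeomInc R) 𝒞 {q} ∧ m ≤ ∑ Y ∈ 𝒞, (Y.card : ℝ), a 𝒞 := by
  calc ∑ 𝒞 ∈ 𝓛 with (∃ q ∈ D, KPTouches (GeomInc R) 𝒞 {q}) ∧ m ≤ ∑ Y ∈ 𝒞, (Y.card : ℝ), a 𝒞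
      ≤ ∑ 𝒞 ∈ 𝓛 with (∃ q ∈ D, KPTouches (GeomInc R) 𝒞 {q}) ∧ m ≤ ∑ Y ∈ 𝒞, (Y.card : ℝ),
          ∑ q ∈ D with KPTouches (GeomInc R) 𝒞 {q} ∧ m ≤ ∑ Y ∈ 𝒞, (Y.card : ℝ), a 𝒞 := by
        refine sum_le_sum fun 𝒞 h𝒞 => ?_
        obtain ⟨⟨q, hqD, hq⟩, hm⟩ := (mem_filter.1 h𝒞).2
        have hmem : q ∈ D.filter fun q => KPTouches (GeomInc R) 𝒞 {q} ∧ m ≤ ∑ Y ∈ 𝒞, (Y.card : ℝ) := mem_filter.2 ⟨hqD, hq, hm⟩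
        calc a 𝒞 = ∑ q' ∈ ({q} : Finset V), a 𝒞 := by simp
          _ ≤ _ := sum_le_sum_of_subset_of_nonneg (by simpa using hmem) fun _ _ _ => ha 𝒞
    _ ≤ ∑ 𝒞 ∈ 𝓛, ∑ q ∈ D with KPTouches (GeomInc R) 𝒞 {q} ∧ m ≤ ∑ Y ∈ 𝒞, (Y.card : ℝ), a 𝒞 :=
        sum_le_sum_of_subset_of_nonneg (filter_subset _ _) fun _ _ _ => sum_nonneg fun _ _ => ha _
    _ = ∑ q ∈ D, ∑ 𝒞 ∈ 𝓛 with KPTouches (GeomInc R) 𝒞 {q} ∧ m ≤ ∑ Y ∈ 𝒞, (Y.card : ℝ), a 𝒞 := by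
        rw [sum_comm' (t' := D) (s' := fun q => 𝓛.filter fun 𝒞 => KPTouches (GeomInc R) 𝒞 {q} ∧ m ≤ ∑ Y ∈ 𝒞, (Y.card : ℝ))]
        intro 𝒞 q
        simp only [mem_filter]
        tauto

/-- **THE END — TWO LOCAL CHANGES AT FAR-APART LOCI MOVE `log Z` BY AN EXPONENTIALLY SMALL MIXED AMOUNT.**  `R` symmetric with `≤ Δ`
neighbours; four families with `‖M_{st}(K)‖ ≤ ε^{#K}` on `R`-connected `K`, `0 ≤ ε`, `0 ≤ τ`, `e^{1+τ}ε(Δ+1)² ≤ 1∕2`; the two agreement letters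
(the `s`-change lives on `D_a`, the `t`-change on `D_b`); SEPARATION: every cluster `𝒞 ⊆ 𝒫(C)` touching both a cell of `D_a` and a cell of
`D_b` has `m ≤ Σ_{Y∈𝒞}#Y` ⟹ `‖log Z₁₁(C) − log Z₁₀(C) − log Z₀₁(C) + log Z₀₀(C)‖ ≤ 4·e^{−τm}·(#D_a·(Δ+1)·2e^{1+τ}ε)`, uniformly in `C`.
[folklore] -/
theorem act_norm_pertLogZ_mixed_le (hR : ∀ x y, R x y → R y x) (hΔ : ∀ x, (nbr x).card ≤ Δ) (hnbr : ∀ x y, R x y → y ∈ nbr x)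
    (h00 : ∀ K : Finset V, IsRConnected R K → ‖cellActivity μ g₀₀ K‖ ≤ ε ^ K.card)
    (h10 : ∀ K : Finset V, IsRConnected R K → ‖cellActivity μ g₁₀ K‖ ≤ ε ^ K.card)
    (h01 : ∀ K : Finset V, IsRConnected R K → ‖cellActivity μ g₀₁ K‖ ≤ ε ^ K.card)
    (h11 : ∀ K : Finset V, IsRConnected R K → ‖cellActivity μ g₁₁ K‖ ≤ ε ^ K.card) (hε : 0 ≤ ε) (hτ : 0 ≤ τ)
    (hsmall : Real.exp (1 + τ) * ε * ((Δ : ℝ) + 1) ^ 2 ≤ 1 / 2) (C Da Db : Finset V)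
    (ha : ∀ K : Finset V, K ⊆ C → Disjoint K Da →
      cellActivity μ g₁₀ K = cellActivity μ g₀₀ K ∧ cellActivity μ g₁₁ K = cellActivity μ g₀₁ K)
    (hb : ∀ K : Finset V, K ⊆ C → Disjoint K Db →
      cellActivity μ g₀₁ K = cellActivity μ g₀₀ K ∧ cellActivity μ g₁₁ K = cellActivity μ g₁₀ K)
    {m : ℝ} (hsep : ∀ 𝒞 ∈ (rconnSubsets R C).powerset, IsPolymerCluster (GeomInc R) 𝒞 →
      (∃ q ∈ Da, KPTouches (GeomInc R) 𝒞 {q}) → (∃ q ∈ Db, KPTouches (GeomInc R) 𝒞 {q}) → m ≤ ∑ Y ∈ 𝒞, (Y.card : ℝ)) :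
    ‖pertLogZ μ g₁₁ R C - pertLogZ μ g₁₀ R C - pertLogZ μ g₀₁ R C + pertLogZ μ g₀₀ R C‖ ≤
      4 * (Real.exp (-(τ * m)) * (Da.card * ((Δ : ℝ) + 1) * (2 * (Real.exp (1 + τ) * ε)))) := by
  classical
  set L := rconnSubsets R C with hL
  set Φ₁₁ : Finset (Finset V) → ℂ := truncatedWeight (GeomInc R) (connActivity R μ g₁₁) with hΦ₁₁
  set Φ₁₀ : Finset (Finset V) → ℂ := truncatedWeight (GeomInc R) (connActivity R μ g₁₀) with hΦ₁₀
  set Φ₀₁ : Finset (Finset V) → ℂ := truncatedWeight (GeomInc R) (connActivity R μ g₀₁) with hΦ₀₁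
  set Φ₀₀ : Finset (Finset V) → ℂ := truncatedWeight (GeomInc R) (connActivity R μ g₀₀) with hΦ₀₀
  have hsmall₁ := smallness_of_decay (Δ := Δ) hε hτ hsmall
  have hexp : pertLogZ μ g₁₁ R C - pertLogZ μ g₁₀ R C - pertLogZ μ g₀₁ R C + pertLogZ μ g₀₀ R C =
      ∑ 𝒞 ∈ L.powerset, (Φ₁₁ 𝒞 - Φ₁₀ 𝒞 - Φ₀₁ 𝒞 + Φ₀₀ 𝒞) := by
    rw [pertLogZ_eq_sum_truncatedWeight, pertLogZ_eq_sum_truncatedWeight, pertLogZ_eq_sum_truncatedWeight,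
      pertLogZ_eq_sum_truncatedWeight, sum_add_distrib, sum_sub_distrib, sum_sub_distrib]
  rw [hexp]
  -- a non-vanishing bracket forces: touching `D_a`, and (cluster through both loci) size `≥ m`
  have hvanish : ∀ 𝒞 ∈ L.powerset, Φ₁₁ 𝒞 - Φ₁₀ 𝒞 - Φ₀₁ 𝒞 + Φ₀₀ 𝒞 ≠ 0 →
      (∃ q ∈ Da, KPTouches (GeomInc R) 𝒞 {q}) ∧ m ≤ ∑ Y ∈ 𝒞, (Y.card : ℝ) := by
    intro 𝒞 h𝒞 hne
    obtain ⟨hcl, hA, hB⟩ := mixed_bracket_support (μ := μ) hR hΔ hnbr h00 h10 h01 h11 hε hsmall₁ C Da Db ha hb h𝒞 hne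
    exact ⟨hA, hsep 𝒞 h𝒞 hcl hA hB⟩
  rw [← sum_filter_of_ne hvanish]
  -- each of the four families: pinned large clusters are exponentially rare ((312))
  have hfam : ∀ {g : V → Ω → ℂ}, (∀ K : Finset V, IsRConnected R K → ‖cellActivity μ g K‖ ≤ ε ^ K.card) →
      ∑ 𝒞 ∈ L.powerset with (∃ q ∈ Da, KPTouches (GeomInc R) 𝒞 {q}) ∧ m ≤ ∑ Y ∈ 𝒞, (Y.card : ℝ),
          ‖truncatedWeight (GeomInc R) (connActivity R μ g) 𝒞‖ ≤
        Real.exp (-(τ * m)) * (Da.card * ((Δ : ℝ) + 1) * (2 * (Real.exp (1 + τ) * ε))) := by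
    intro g hg
    calc _ ≤ ∑ q ∈ Da, ∑ 𝒞 ∈ L.powerset with KPTouches (GeomInc R) 𝒞 {q} ∧ m ≤ ∑ Y ∈ 𝒞, (Y.card : ℝ),
          ‖truncatedWeight (GeomInc R) (connActivity R μ g) 𝒞‖ := sum_norm_le_sum_pinned_large _ Da m _ fun _ => norm_nonneg _
      _ ≤ ∑ q ∈ Da, Real.exp (-(τ * m)) * ((({q} : Finset V).card : ℝ) * ((Δ : ℝ) + 1) * (2 * (Real.exp (1 + τ) * ε))) :=
          sum_le_sum fun q _ => act_sum_norm_truncatedWeight_large_pinned_le hR hΔ hnbr hg hε hτ hsmall C {q} m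
      _ = Real.exp (-(τ * m)) * (Da.card * ((Δ : ℝ) + 1) * (2 * (Real.exp (1 + τ) * ε))) := by
          simp only [card_singleton, Nat.cast_one, one_mul, sum_const, nsmul_eq_mul]
          ring
  calc ‖∑ 𝒞 ∈ L.powerset with (∃ q ∈ Da, KPTouches (GeomInc R) 𝒞 {q}) ∧ m ≤ ∑ Y ∈ 𝒞, (Y.card : ℝ),
          (Φ₁₁ 𝒞 - Φ₁₀ 𝒞 - Φ₀₁ 𝒞 + Φ₀₀ 𝒞)‖
      ≤ ∑ 𝒞 ∈ L.powerset with (∃ q ∈ Da, KPTouches (GeomInc R) 𝒞 {q}) ∧ m ≤ ∑ Y ∈ 𝒞, (Y.card : ℝ),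
          ‖Φ₁₁ 𝒞 - Φ₁₀ 𝒞 - Φ₀₁ 𝒞 + Φ₀₀ 𝒞‖ := norm_sum_le _ _
    _ ≤ ∑ 𝒞 ∈ L.powerset with (∃ q ∈ Da, KPTouches (GeomInc R) 𝒞 {q}) ∧ m ≤ ∑ Y ∈ 𝒞, (Y.card : ℝ),
          (‖Φ₁₁ 𝒞‖ + ‖Φ₁₀ 𝒞‖ + ‖Φ₀₁ 𝒞‖ + ‖Φ₀₀ 𝒞‖) := sum_le_sum fun 𝒞 _ => by
        calc ‖Φ₁₁ 𝒞 - Φ₁₀ 𝒞 - Φ₀₁ 𝒞 + Φ₀₀ 𝒞‖ ≤ ‖Φ₁₁ 𝒞 - Φ₁₀ 𝒞 - Φ₀₁ 𝒞‖ + ‖Φ₀₀ 𝒞‖ := norm_add_le _ _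
          _ ≤ ‖Φ₁₁ 𝒞 - Φ₁₀ 𝒞‖ + ‖Φ₀₁ 𝒞‖ + ‖Φ₀₀ 𝒞‖ := by linarith [norm_sub_le (Φ₁₁ 𝒞 - Φ₁₀ 𝒞) (Φ₀₁ 𝒞)]
          _ ≤ ‖Φ₁₁ 𝒞‖ + ‖Φ₁₀ 𝒞‖ + ‖Φ₀₁ 𝒞‖ + ‖Φ₀₀ 𝒞‖ := by linarith [norm_sub_le (Φ₁₁ 𝒞) (Φ₁₀ 𝒞)]
    _ ≤ 4 * (Real.exp (-(τ * m)) * (Da.card * ((Δ : ℝ) + 1) * (2 * (Real.exp (1 + τ) * ε)))) := by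
        rw [sum_add_distrib, sum_add_distrib, sum_add_distrib]
        linarith [hfam h11, hfam h10, hfam h01, hfam h00]

/-! ## §3. Toy -/

/-- Toy (§1): the EMPTY family of polymers touches no cell of any locus. -/
example (D : Finset (Fin 2)) :
    ¬ ∃ q ∈ D, KPTouches (GeomInc (fun _ _ : Fin 2 => False)) (∅ : Finset (Finset (Fin 2))) {q} := by
  simp [KPTouches]

end Summit.QuantumFields.BalabanUV.T4Continuum.NE7b.SupEffectiveActionMixedLocality
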